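import Summits.QuantumFields.BalabanUV.T4Continuum.Support.CTGaugeSandwichHbd

/-!
# T⁴ programme, spine node NE2 (U1a), sub-row Δ3 «NE2-WALK» (T4-DAG `T4-U1a.S-NE2-D3-WALK°`) — THE UNIT-LAYER FACTOR `N = (Q′G′G′Q′ᴴ)⁻¹` OF THE
# GAUGE SANDWICH UNDER THE COARSE CONJUGATION: `‖c(G′) − G′‖ = O(κ)` `n`-uniformly (resolvent identity), `‖c(K) − K‖ ≤ deltaKU`, and
# `‖c(N)‖ ≤ (σK − deltaKU)⁻¹` from the unit datum `Coercive σK K` — file E2b of «Δ3-CT-HBD-B4»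

NE2 formalisation swarm `b2b-balaban-t4-ne2-formalise-*`, leaf prover 06 (gen 3), supplier item «Δ3-CT-HBD-B4» file E2b (E1 =
`Support/CTCovariantScalarGreen`, E2a = `Support/CTGaugeSandwichHbd`).  One level `n`; `Q′ = B·siteMul T`, `S_U = scalarOp n M a′ R T`, `G′ = S_U⁻¹`,
site weight `ρ₀` (`1/n`-Lipschitz, block oscillation `≤ 1`), coarse weight `σ` on `Tor M × o`:
 * §4 **`opNorm_conjMat_massTerm_sub_le`** (`‖c(Y) − Y‖ ≤ a′(1+τ)²(e^{|κ|Λ} − 1)`, substrate's `opNorm_conjMat_PiS_sub_le` and `ScalarCovariantCoercive.gram_eq_sandwich`), and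
   **`opNorm_conjMat_scalarOp_inv_sub_le`**: `‖c(G′) − G′‖ ≤ gR (card o) d a′ α τ κ` by the RESOLVENT IDENTITY `c(G′) − G′ = c(G′)(S − c(S))G′`,
   `c(S) − S = c(D_Rᴴ)(c(D_R) − D_R) + (c(D_Rᴴ) − D_Rᴴ)D_R + (c(Y) − Y)` — every factor `n`-uniform (E1's `K₂`, `cR`, the unweighted
   `‖D_RG′‖ ≤ √‖G′‖` of `GaugeTermResolventBounds.opNorm_mul_inv_le_sqrt`), although `‖c(S) − S‖` itself is NOT;
 * §5 **`opNorm_conjMat_gramK_sub_le`** (`‖c(K) − K‖ ≤ deltaKU`, `K = (Q′G′)(G′Q′ᴴ)` telescoped) and **`opNorm_conjMat_Nop_le`**: with the unit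
   datum `hK : Coercive σK K` DISPLAYED and `deltaKU < σK`, `‖conjMat κ σ σ N‖ ≤ (σK − deltaKU)⁻¹` (`CTConjugationPieces.opNorm_conjMat_inv_le`,
   `conjMat_inv`).  At `R = 1`, `T = 1` the datum is the substrate's `CTGaugeTerm.coercive_Kcomp` lifted (`GaugeTermScalarData.gram_one_eq`,
   `GaugeTermCoercivity.coercive_kron_one`); for the background family it is row B4's unit datum (Neumann around the free one).

HONEST FRAMING (T4-DAG p. 1).  Bookkeeping over landed modules ([folklore]); statements and the constants `gR`, `deltaKU` OURS; MODEL level (no B0);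
`hK` DISPLAYED; Δ3 NOT closed; NE2 (U1a) NOT PROVED; spine PROVED 0/9 unchanged; NOT infinite volume, NOT a mass gap, NOT the Clay problem, NOT
summit progress.  HONEST DEPENDENCY: continuum YM on T⁴ ⇐ BetaPertH ∧ nine spine estimates (0/9 proved); BetaPertH ⇐ (D1) ∧ (D4) ∧ CAP+tail;
G-an2-4 gates asym, D1 and NE2/3/4.  ABSOLUTE RULE kept; no `sorry`.
-/

noncomputable section

open scoped BigOperators ComplexConjugate Matrix Matrix.Norms.L2Operator Kronecker ComplexOrder

namespace Summit.QuantumFields.BalabanUV.T4Continuum.CTGaugeUnitFactorHbd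

open Literature.MathematicalPhysics.QuantumFieldTheory.Balaban1983to89.B5Prop11Plancherel (Tor fine unitVec)
open Literature.MathematicalPhysics.QuantumFieldTheory.Balaban1983to89.B5Blocks16 (blockOf)
open Summit.QuantumFields.BalabanUV.T4Continuum
open Summit.QuantumFields.BalabanUV.T4Continuum.CoerciveInverseTower (Coercive)
open Summit.QuantumFields.BalabanUV.T4Continuum.BlockMultiplication (siteMul siteMul_apply opNorm_siteMul_le siteMul_conjTranspose)
open Summit.QuantumFields.BalabanUV.T4Continuum.KroneckerLift (opNorm_kron_le_of_le sub_kronecker)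
open Summit.QuantumFields.BalabanUV.T4Continuum.GaugeTermDecomposition (covGrad sand)
open Summit.QuantumFields.BalabanUV.T4Continuum.GaugeTermSandwichBound (projP Zop Nop sand_projP_eq)
open Summit.QuantumFields.BalabanUV.T4Continuum.GaugeTermResolventBounds (opNorm_mul_inv_le_sqrt)
open Summit.QuantumFields.BalabanUV.T4Continuum.ScalarAveragedCompression (Qiso opNorm_Qiso_le)
open Summit.QuantumFields.BalabanUV.T4Continuum.ScalarBlockPoincare (PiS)
open Summit.QuantumFields.BalabanUV.T4Continuum.ScalarCovariantLaplacian (scalarOp connS Bs opNorm_Bs_le Bs_conjTranspose_mul_Bs)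
open Summit.QuantumFields.BalabanUV.T4Continuum.ScalarCovariantCoercive (gammaU siteW Jcov Jcov_nonneg scalarOp_isHermitian
  opNorm_siteMul_le_one_add isUnit_scalarOp opNorm_scalarOp_inv_le gram_eq_sandwich)
open Summit.QuantumFields.BalabanUV.T4Continuum.CTWeightedCoercivity
open Summit.QuantumFields.BalabanUV.T4Continuum.CTConjugationPieces (opNorm_conjMat_le_add conjMat_of_sameWeight conjMat_conjTranspose
  opNorm_conjMat_conjTranspose_sub_eq conjMat_inv opNorm_conjMat_inv_le)
open Summit.QuantumFields.BalabanUV.T4Continuum.CTConjugationTorus (coarseW opNorm_conjMat_PiS_sub_le)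
open Summit.QuantumFields.BalabanUV.T4Continuum.CTWeightedEnergy (K1 K2 K1_nonneg K2_nonneg)
open Summit.QuantumFields.BalabanUV.T4Continuum.CTCovariantLaplacianDecay (conjMat_kron)
open Summit.QuantumFields.BalabanUV.T4Continuum.CTCovariantScalarGreen
open Summit.QuantumFields.BalabanUV.T4Continuum.CTGaugeSandwichHbd

variable {d : ℕ} (n : ℕ) [NeZero n] (M : Fin d → ℕ) [hM : ∀ μ, NeZero (M μ)]
variable {o : Type*} [Fintype o] [DecidableEq o]

/-! ## §4 The conjugation error of `G′` itself (resolvent identity) -/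

section GreenError

variable {ρ₀ : Tor (fine n M) → ℝ} {κ a' : ℝ}
variable {R : Fin d → (Tor (fine n M) → Matrix o o ℂ)} {T : Tor (fine n M) → Matrix o o ℂ} {α τ : ℝ}

/-- **`‖c(Y) − Y‖ ≤ a′(1 + τ)²(e^{|κ|Λ} − 1)`** for the mass term `Y = a′(BT)ᴴ(BT)` (substrate's `opNorm_conjMat_PiS_sub_le`). [folklore] -/
theorem opNorm_conjMat_massTerm_sub_le (ha' : 0 ≤ a') (κ : ℝ) {Λ : ℝ} (hΛ : 0 ≤ Λ) (hτ : 0 ≤ τ)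
    (hosc : ∀ x x', blockOf n M x = blockOf n M x' → |ρ₀ x - ρ₀ x'| ≤ Λ) (hT : ∀ x, ‖T x - 1‖ ≤ τ) :
    ‖conjMat κ (siteW n M ρ₀) (siteW n M ρ₀) ((a' : ℂ) • ((Bs o n M * siteMul T)ᴴ * (Bs o n M * siteMul T)))
        - (a' : ℂ) • ((Bs o n M * siteMul T)ᴴ * (Bs o n M * siteMul T))‖ ≤ a' * (1 + τ) ^ 2 * (Real.exp (|κ| * Λ) - 1) := by
  have hP : ‖conjMat κ (siteW n M ρ₀) (siteW n M ρ₀) (PiS n M ⊗ₖ (1 : Matrix o o ℂ)) - PiS n M ⊗ₖ (1 : Matrix o o ℂ)‖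
      ≤ Real.exp (|κ| * Λ) - 1 := by
    have e : conjMat κ (siteW n M ρ₀) (siteW n M ρ₀) (PiS n M ⊗ₖ (1 : Matrix o o ℂ)) = conjMat κ ρ₀ ρ₀ (PiS n M) ⊗ₖ (1 : Matrix o o ℂ) :=
      conjMat_kron κ ρ₀ ρ₀ (PiS n M) (1 : Matrix o o ℂ)
    rw [e, ← sub_kronecker]
    exact opNorm_kron_le_of_le o (opNorm_conjMat_PiS_sub_le n M κ hΛ hosc)
  have hTH : ∀ x, ‖(fun x => (T x)ᴴ) x - 1‖ ≤ τ := fun x => by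
    show ‖(T x)ᴴ - 1‖ ≤ τ
    rw [← Matrix.conjTranspose_one, ← Matrix.conjTranspose_sub, Matrix.l2_opNorm_conjTranspose]; exact hT x
  rw [gram_eq_sandwich, conjMat_smul, ← smul_sub, norm_smul, Complex.norm_real, Real.norm_of_nonneg ha',
    conjMat_mul κ _ (siteW n M ρ₀) _, conjMat_mul κ _ (siteW n M ρ₀) _, conjMat_siteMul_site, conjMat_siteMul_site, ← Matrix.sub_mul,
    ← Matrix.mul_sub]
  have h1 := opNorm_siteMul_le_one_add n M hτ hTH
  have h2 := opNorm_siteMul_le_one_add n M hτ hT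
  have hE : 0 ≤ Real.exp (|κ| * Λ) - 1 := sub_nonneg.mpr (Real.one_le_exp (by positivity))
  rw [mul_assoc a']
  refine mul_le_mul_of_nonneg_left ?_ ha'
  calc _ ≤ ‖siteMul (fun x => (T x)ᴴ) * (conjMat κ (siteW n M ρ₀) (siteW n M ρ₀) (PiS n M ⊗ₖ (1 : Matrix o o ℂ)) - PiS n M ⊗ₖ (1 : Matrix o o ℂ))‖
          * ‖siteMul T‖ := Matrix.l2_opNorm_mul _ _
    _ ≤ (‖siteMul (fun x => (T x)ᴴ)‖ * ‖conjMat κ (siteW n M ρ₀) (siteW n M ρ₀) (PiS n M ⊗ₖ (1 : Matrix o o ℂ)) - PiS n M ⊗ₖ (1 : Matrix o o ℂ)‖)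
          * ‖siteMul T‖ := mul_le_mul_of_nonneg_right (Matrix.l2_opNorm_mul _ _) (norm_nonneg _)
    _ ≤ ((1 + τ) * (Real.exp (|κ| * Λ) - 1)) * (1 + τ) :=
        mul_le_mul (mul_le_mul h1 hP (norm_nonneg _) (by positivity)) h2 (norm_nonneg _) (by positivity)
    _ = (1 + τ) ^ 2 * (Real.exp (|κ| * Λ) - 1) := by ring

end GreenError


section GreenError

variable {ρ₀ : Tor (fine n M) → ℝ} {κ a' : ℝ}
variable {R : Fin d → (Tor (fine n M) → Matrix o o ℂ)} {T : Tor (fine n M) → Matrix o o ℂ} {α τ : ℝ}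

/-- the conjugation error of `G′`: `gR = K₂·cR·γ_U⁻¹ + γw⁻¹·cR·√(γ_U⁻¹) + γw⁻¹·a′(1+τ)²(e^{|κ|} − 1)·γ_U⁻¹` (`γw = γ_U − Jcov`). [folklore] -/
def gR (co d : ℕ) (a' α τ κ : ℝ) : ℝ :=
  K2 (gammaU d a' α τ - Jcov co d a' α τ κ) (Jcov co d a' α τ κ) (cR d α κ) * cR d α κ * (gammaU d a' α τ)⁻¹
    + (gammaU d a' α τ - Jcov co d a' α τ κ)⁻¹ * cR d α κ * Real.sqrt ((gammaU d a' α τ)⁻¹)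
    + (gammaU d a' α τ - Jcov co d a' α τ κ)⁻¹ * (a' * (1 + τ) ^ 2 * (Real.exp (|κ| * 1) - 1)) * (gammaU d a' α τ)⁻¹

/-- **`‖c(G′) − G′‖ ≤ gR`**, `n`-UNIFORMLY, by the resolvent identity `c(G′) − G′ = c(G′)·(S − c(S))·G′` with
`c(S) − S = c(D_Rᴴ)(c(D_R) − D_R) + (c(D_Rᴴ) − D_Rᴴ)D_R + (c(Y) − Y)` (no `‖c(S) − S‖`, which is NOT `n`-uniform). [folklore] -/
theorem opNorm_conjMat_scalarOp_inv_sub_le (ha' : 0 < a') (hα : 0 ≤ α) (hτ : 0 ≤ τ)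
    (hR : ∀ μ x, ‖connS (fine n M) ((n : ℕ) : ℂ) R μ x‖ ≤ α) (hT : ∀ x, ‖T x - 1‖ ≤ τ)
    (hlip : ∀ x ν, |ρ₀ (x + unitVec (fine n M) ν) - ρ₀ x| ≤ 1 / n) (hosc : ∀ x x', blockOf n M x = blockOf n M x' → |ρ₀ x - ρ₀ x'| ≤ 1)
    (hγU : 0 < gammaU d a' α τ) (hγ : 0 < gammaU d a' α τ - Jcov (Fintype.card o) d a' α τ κ) :
    ‖conjMat κ (siteW n M ρ₀) (siteW n M ρ₀) (scalarOp n M a' R T)⁻¹ - (scalarOp n M a' R T)⁻¹‖ ≤ gR (Fintype.card o) d a' α τ κ := by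
  set S := scalarOp n M a' R T with hSdef
  set D := covGrad (fine n M) ((n : ℕ) : ℂ) R with hDdef
  set Y := (a' : ℂ) • ((Bs o n M * siteMul T)ᴴ * (Bs o n M * siteMul T)) with hYdef
  have hS : S = Dᴴ * D + Y := scalarOp_eq_gram n M a' R T
  have hY : Y.PosSemidef := massTerm_posSemidef n M ha'.le T
  have hSunit : IsUnit S := isUnit_scalarOp n M ha' hα hτ hR hT hγU
  have hSU : IsUnit S.det := (Matrix.isUnit_iff_isUnit_det S).mp hSunit
  -- abbreviations for the conjugated objects
  set cG := conjMat κ (siteW n M ρ₀) (siteW n M ρ₀) S⁻¹ with hcG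
  set cD := conjMat κ (bondCW n M (o := o) ρ₀) (siteW n M ρ₀) D with hcD
  set cDH := conjMat κ (siteW n M ρ₀) (bondCW n M (o := o) ρ₀) Dᴴ with hcDH
  set cY := conjMat κ (siteW n M ρ₀) (siteW n M ρ₀) Y with hcY
  -- the resolvent identity
  have hGS : S⁻¹ * S = 1 := Matrix.nonsing_inv_mul S hSU
  have hSG : S * S⁻¹ = 1 := Matrix.mul_nonsing_inv S hSU
  have hcGcS : cG * conjMat κ (siteW n M ρ₀) (siteW n M ρ₀) S = 1 := by
    rw [hcG, ← conjMat_mul, hGS, conjMat_one]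
  have hcS : conjMat κ (siteW n M ρ₀) (siteW n M ρ₀) S = cDH * cD + cY := by
    rw [hS, conjMat_add, conjMat_mul κ _ (bondCW n M (o := o) ρ₀) _]
  have hid : cG - S⁻¹ = cG * cDH * ((D - cD) * S⁻¹) + cG * (Dᴴ - cDH) * (D * S⁻¹) + cG * (Y - cY) * S⁻¹ := by
    have e1 : cG - S⁻¹ = cG * (S - conjMat κ (siteW n M ρ₀) (siteW n M ρ₀) S) * S⁻¹ := by
      rw [Matrix.mul_sub, Matrix.sub_mul, hcGcS, Matrix.one_mul, Matrix.mul_assoc, hSG, Matrix.mul_one]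
    rw [e1, hcS, hS]
    simp only [Matrix.mul_sub, Matrix.sub_mul, Matrix.mul_add, Matrix.add_mul, Matrix.mul_assoc]
    abel
  -- the six norms
  have hK2 : ‖cG * cDH‖ ≤ K2 (gammaU d a' α τ - Jcov (Fintype.card o) d a' α τ κ) (Jcov (Fintype.card o) d a' α τ κ) (cR d α κ) := by
    rw [hcG, hcDH, ← conjMat_mul]
    exact opNorm_conjMat_inv_covGradH_le n M ha' hα hτ hR hT hlip hosc hγ
  have hcD' : ‖D - cD‖ ≤ cR d α κ := by rw [norm_sub_rev]; exact opNorm_conjMat_covGrad_sub_le n M hα hR hlip κ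
  have hcDH' : ‖Dᴴ - cDH‖ ≤ cR d α κ := by rw [norm_sub_rev]; exact opNorm_conjMat_covGradH_sub_le n M hα hR hlip κ
  have hcY' : ‖Y - cY‖ ≤ a' * (1 + τ) ^ 2 * (Real.exp (|κ| * 1) - 1) := by
    rw [norm_sub_rev]; exact opNorm_conjMat_massTerm_sub_le n M ha'.le κ zero_le_one hτ hosc hT
  have hG : ‖S⁻¹‖ ≤ (gammaU d a' α τ)⁻¹ := opNorm_scalarOp_inv_le n M ha' hα hτ hR hT hγU
  have hcGn : ‖cG‖ ≤ (gammaU d a' α τ - Jcov (Fintype.card o) d a' α τ κ)⁻¹ := opNorm_conjMat_scalarOp_inv_le n M ha' hα hτ hR hT hlip hosc hγ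
  have hDG : ‖D * S⁻¹‖ ≤ Real.sqrt ((gammaU d a' α τ)⁻¹) :=
    (opNorm_mul_inv_le_sqrt hS hY hSU).trans (Real.sqrt_le_sqrt hG)
  have hK2nn := K2_nonneg (gammaU d a' α τ - Jcov (Fintype.card o) d a' α τ κ) (Jcov (Fintype.card o) d a' α τ κ) (cR d α κ)
  have hcRnn := cR_nonneg d hα κ
  rw [hid]
  refine (norm_add_le _ _).trans ((add_le_add ((norm_add_le _ _).trans (add_le_add ?_ ?_)) ?_).trans (le_of_eq (by rw [gR])))
  · calc ‖cG * cDH * ((D - cD) * S⁻¹)‖ ≤ ‖cG * cDH‖ * ‖(D - cD) * S⁻¹‖ := Matrix.l2_opNorm_mul _ _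
      _ ≤ ‖cG * cDH‖ * (‖D - cD‖ * ‖S⁻¹‖) := mul_le_mul_of_nonneg_left (Matrix.l2_opNorm_mul _ _) (norm_nonneg _)
      _ ≤ K2 _ _ _ * (cR d α κ * (gammaU d a' α τ)⁻¹) :=
          mul_le_mul hK2 (mul_le_mul hcD' hG (norm_nonneg _) hcRnn) (by positivity) hK2nn
      _ = _ := by ring
  · calc ‖cG * (Dᴴ - cDH) * (D * S⁻¹)‖ ≤ ‖cG * (Dᴴ - cDH)‖ * ‖D * S⁻¹‖ := Matrix.l2_opNorm_mul _ _
      _ ≤ (‖cG‖ * ‖Dᴴ - cDH‖) * ‖D * S⁻¹‖ := mul_le_mul_of_nonneg_right (Matrix.l2_opNorm_mul _ _) (norm_nonneg _)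
      _ ≤ ((gammaU d a' α τ - Jcov (Fintype.card o) d a' α τ κ)⁻¹ * cR d α κ) * Real.sqrt ((gammaU d a' α τ)⁻¹) :=
          mul_le_mul (mul_le_mul hcGn hcDH' (norm_nonneg _) (by positivity)) hDG (norm_nonneg _) (by positivity)
  · calc ‖cG * (Y - cY) * S⁻¹‖ ≤ ‖cG * (Y - cY)‖ * ‖S⁻¹‖ := Matrix.l2_opNorm_mul _ _
      _ ≤ (‖cG‖ * ‖Y - cY‖) * ‖S⁻¹‖ := mul_le_mul_of_nonneg_right (Matrix.l2_opNorm_mul _ _) (norm_nonneg _)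
      _ ≤ ((gammaU d a' α τ - Jcov (Fintype.card o) d a' α τ κ)⁻¹ * (a' * (1 + τ) ^ 2 * (Real.exp (|κ| * 1) - 1))) * (gammaU d a' α τ)⁻¹ := by
          have h0 : 0 ≤ a' * (1 + τ) ^ 2 * (Real.exp (|κ| * 1) - 1) :=
            mul_nonneg (by positivity) (sub_nonneg.mpr (Real.one_le_exp (by positivity)))
          exact mul_le_mul (mul_le_mul hcGn hcY' (norm_nonneg _) (by positivity)) hG (norm_nonneg _) (by positivity)

end GreenError


/-! ## §5 The unit-layer factor `N = (Q′G′G′Q′ᴴ)⁻¹` under the coarse conjugation, from a coercivity of `K` -/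

section UnitFactor

variable {ρ₀ : Tor (fine n M) → ℝ} {κ a' : ℝ}
variable {R : Fin d → (Tor (fine n M) → Matrix o o ℂ)} {T : Tor (fine n M) → Matrix o o ℂ} {α τ σK : ℝ}

/-- the conjugation error of `K = Q′G′G′Q′ᴴ` (`εQ = (e^{|κ|} − 1)(1+τ)`, `w₁ = εQ·γw⁻¹ + (1+τ)·gR`,
`v₁ = gR·e^{|κ|}(1+τ) + γ_U⁻¹·εQ`): `deltaKU = w₁·γw⁻¹e^{|κ|}(1+τ) + (1+τ)γ_U⁻¹·v₁`. [folklore] -/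
def deltaKU (co d : ℕ) (a' α τ κ : ℝ) : ℝ :=
  (((Real.exp (|κ| * 1) - 1) * (1 + τ)) * (gammaU d a' α τ - Jcov co d a' α τ κ)⁻¹ + (1 + τ) * gR co d a' α τ κ)
      * ((gammaU d a' α τ - Jcov co d a' α τ κ)⁻¹ * (Real.exp |κ| * (1 + τ)))
    + ((1 + τ) * (gammaU d a' α τ)⁻¹)
      * (gR co d a' α τ κ * (Real.exp (|κ| * 1) * (1 + τ)) + (gammaU d a' α τ)⁻¹ * ((Real.exp (|κ| * 1) - 1) * (1 + τ)))

/-- **`‖c(K) − K‖ ≤ deltaKU`** for `K = Q′G′G′Q′ᴴ` under the coarse weight (`K = (Q′G′)(G′Q′ᴴ)`, telescoping). [folklore] -/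
theorem opNorm_conjMat_gramK_sub_le (ha' : 0 < a') (hα : 0 ≤ α) (hτ : 0 ≤ τ)
    (hR : ∀ μ x, ‖connS (fine n M) ((n : ℕ) : ℂ) R μ x‖ ≤ α) (hT : ∀ x, ‖T x - 1‖ ≤ τ)
    (hlip : ∀ x ν, |ρ₀ (x + unitVec (fine n M) ν) - ρ₀ x| ≤ 1 / n) (hosc : ∀ x x', blockOf n M x = blockOf n M x' → |ρ₀ x - ρ₀ x'| ≤ 1)
    (hγU : 0 < gammaU d a' α τ) (hγ : 0 < gammaU d a' α τ - Jcov (Fintype.card o) d a' α τ κ) :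
    ‖conjMat κ (coarseCW n M (o := o) ρ₀) (coarseCW n M (o := o) ρ₀)
        ((Bs o n M * siteMul T) * (scalarOp n M a' R T)⁻¹ * (scalarOp n M a' R T)⁻¹ * (Bs o n M * siteMul T)ᴴ)
      - (Bs o n M * siteMul T) * (scalarOp n M a' R T)⁻¹ * (scalarOp n M a' R T)⁻¹ * (Bs o n M * siteMul T)ᴴ‖
      ≤ deltaKU (Fintype.card o) d a' α τ κ := by
  set Q := Bs o n M * siteMul T with hQdef
  set G := (scalarOp n M a' R T)⁻¹ with hGdef
  set σ := coarseCW n M (o := o) ρ₀ with hσ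
  set ρ := siteW n M (o := o) ρ₀ with hρ
  set cQ := conjMat κ σ ρ Q
  set cQH := conjMat κ ρ σ Qᴴ
  set cG := conjMat κ ρ ρ G
  -- sizes
  have hEQ : 0 ≤ (Real.exp (|κ| * 1) - 1) * (1 + τ) := mul_nonneg (sub_nonneg.mpr (Real.one_le_exp (by positivity))) (by positivity)
  have hQn : ‖Q‖ ≤ 1 + τ := by
    calc ‖Q‖ ≤ ‖Bs o n M‖ * ‖siteMul T‖ := Matrix.l2_opNorm_mul _ _
      _ ≤ 1 * (1 + τ) := mul_le_mul (opNorm_Bs_le o n M) (opNorm_siteMul_le_one_add n M hτ hT) (norm_nonneg _) zero_le_one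
      _ = 1 + τ := one_mul _
  have hcQsub : ‖cQ - Q‖ ≤ (Real.exp (|κ| * 1) - 1) * (1 + τ) := opNorm_conjMat_Qu_sub_le n M κ zero_le_one hτ hosc hT
  have hcQHsub : ‖cQH - Qᴴ‖ ≤ (Real.exp (|κ| * 1) - 1) * (1 + τ) := by
    show ‖conjMat κ ρ σ Qᴴ - Qᴴ‖ ≤ _
    rw [opNorm_conjMat_conjTranspose_sub_eq]
    have h := opNorm_conjMat_Qu_sub_le n M (ρ₀ := ρ₀) (o := o) (-κ) zero_le_one hτ hosc hT
    rwa [abs_neg] at h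
  have hcQHn : ‖cQH‖ ≤ Real.exp (|κ| * 1) * (1 + τ) := opNorm_conjMat_QuH_le n M κ zero_le_one hτ hosc hT
  have hGn : ‖G‖ ≤ (gammaU d a' α τ)⁻¹ := opNorm_scalarOp_inv_le n M ha' hα hτ hR hT hγU
  have hcGn : ‖cG‖ ≤ (gammaU d a' α τ - Jcov (Fintype.card o) d a' α τ κ)⁻¹ :=
    opNorm_conjMat_scalarOp_inv_le n M ha' hα hτ hR hT hlip hosc hγ
  have hcGsub : ‖cG - G‖ ≤ gR (Fintype.card o) d a' α τ κ := opNorm_conjMat_scalarOp_inv_sub_le n M ha' hα hτ hR hT hlip hosc hγU hγ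
  have hgR : 0 ≤ gR (Fintype.card o) d a' α τ κ := (norm_nonneg _).trans hcGsub
  -- the two factors `W = QG`, `V = GQᴴ`
  have hW : ‖cQ * cG - Q * G‖ ≤ ((Real.exp (|κ| * 1) - 1) * (1 + τ)) * (gammaU d a' α τ - Jcov (Fintype.card o) d a' α τ κ)⁻¹
      + (1 + τ) * gR (Fintype.card o) d a' α τ κ := by
    rw [show cQ * cG - Q * G = (cQ - Q) * cG + Q * (cG - G) by rw [Matrix.sub_mul, Matrix.mul_sub]; abel]
    exact (norm_add_le _ _).trans (add_le_add
      ((Matrix.l2_opNorm_mul _ _).trans (mul_le_mul hcQsub hcGn (norm_nonneg _) hEQ))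
      ((Matrix.l2_opNorm_mul _ _).trans (mul_le_mul hQn hcGsub (norm_nonneg _) (by positivity))))
  have hV : ‖cG * cQH - G * Qᴴ‖ ≤ gR (Fintype.card o) d a' α τ κ * (Real.exp (|κ| * 1) * (1 + τ))
      + (gammaU d a' α τ)⁻¹ * ((Real.exp (|κ| * 1) - 1) * (1 + τ)) := by
    rw [show cG * cQH - G * Qᴴ = (cG - G) * cQH + G * (cQH - Qᴴ) by rw [Matrix.sub_mul, Matrix.mul_sub]; abel]
    exact (norm_add_le _ _).trans (add_le_add
      ((Matrix.l2_opNorm_mul _ _).trans (mul_le_mul hcGsub hcQHn (norm_nonneg _) hgR))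
      ((Matrix.l2_opNorm_mul _ _).trans (mul_le_mul hGn hcQHsub (norm_nonneg _) (by positivity))))
  have hcVn : ‖cG * cQH‖ ≤ (gammaU d a' α τ - Jcov (Fintype.card o) d a' α τ κ)⁻¹ * (Real.exp |κ| * (1 + τ)) := by
    have h := hcQHn; rw [mul_one] at h
    exact (Matrix.l2_opNorm_mul _ _).trans (mul_le_mul hcGn h (norm_nonneg _) (by positivity))
  have hWn : ‖Q * G‖ ≤ (1 + τ) * (gammaU d a' α τ)⁻¹ :=
    (Matrix.l2_opNorm_mul _ _).trans (mul_le_mul hQn hGn (norm_nonneg _) (by positivity))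
  -- conjugate the product and telescope
  have e : conjMat κ σ σ (Q * G * G * Qᴴ) - Q * G * G * Qᴴ = (cQ * cG - Q * G) * (cG * cQH) + (Q * G) * (cG * cQH - G * Qᴴ) := by
    rw [conjMat_mul κ σ ρ σ, conjMat_mul κ σ ρ ρ, conjMat_mul κ σ ρ ρ]
    simp only [Matrix.sub_mul, Matrix.mul_sub, Matrix.mul_assoc]
    abel
  rw [e]
  have h0W : 0 ≤ (1 + τ) * (gammaU d a' α τ)⁻¹ := by positivity
  refine (norm_add_le _ _).trans ((add_le_add ((Matrix.l2_opNorm_mul _ _).trans (mul_le_mul hW hcVn (norm_nonneg _)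
    (by positivity))) ((Matrix.l2_opNorm_mul _ _).trans (mul_le_mul hWn hV (norm_nonneg _) h0W))).trans (le_of_eq ?_))
  rw [deltaKU]

/-- **THE CONJUGATED UNIT-LAYER FACTOR**: if `K = Q′G′G′Q′ᴴ` is `σK`-coercive (the unit datum of the family) and `deltaKU < σK`, then
`‖conjMat κ σ σ N‖ ≤ (σK − deltaKU)⁻¹` (`CTConjugationPieces.opNorm_conjMat_inv_le`, `conjMat_inv`). [folklore] -/
theorem opNorm_conjMat_Nop_le (ha' : 0 < a') (hα : 0 ≤ α) (hτ : 0 ≤ τ)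
    (hR : ∀ μ x, ‖connS (fine n M) ((n : ℕ) : ℂ) R μ x‖ ≤ α) (hT : ∀ x, ‖T x - 1‖ ≤ τ)
    (hlip : ∀ x ν, |ρ₀ (x + unitVec (fine n M) ν) - ρ₀ x| ≤ 1 / n) (hosc : ∀ x x', blockOf n M x = blockOf n M x' → |ρ₀ x - ρ₀ x'| ≤ 1)
    (hγU : 0 < gammaU d a' α τ) (hγ : 0 < gammaU d a' α τ - Jcov (Fintype.card o) d a' α τ κ)
    (hK : Coercive σK ((Bs o n M * siteMul T) * (scalarOp n M a' R T)⁻¹ * (scalarOp n M a' R T)⁻¹ * (Bs o n M * siteMul T)ᴴ))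
    (hδ : deltaKU (Fintype.card o) d a' α τ κ < σK) :
    ‖conjMat κ (coarseCW n M (o := o) ρ₀) (coarseCW n M (o := o) ρ₀) (Nop (fine n M) (scalarOp n M a' R T)⁻¹ (Bs o n M * siteMul T))‖
      ≤ (σK - deltaKU (Fintype.card o) d a' α τ κ)⁻¹ := by
  rw [Nop, conjMat_inv]
  exact opNorm_conjMat_inv_le hK κ _ (opNorm_conjMat_gramK_sub_le n M ha' hα hτ hR hT hlip hosc hγU hγ) hδ

end UnitFactor

end Summit.QuantumFields.BalabanUV.T4Continuum.CTGaugeUnitFactorHbd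

end
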